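import Summits.QuantumFields.YangMills.Theorems.BalabanUVNodesN11GaussianCertificateRows

/-!
# DAG node N11 — DEFINITION: THE GAUSSIAN CERTIFICATE `gaussPinH θ` of a v1.7 parameter (the named member of the Gaussian certificate class of
# `…N11GaussianCertificateRows`: certificate `ζ0`, A-fibre Gaussian `quad`), its `rfl` faces, the K⁷ antecedent at it, and the no-expansion 𝐓-step at it modulo def-T's rows

HEADER — WORK-UNIT METADATA.  Cell `pub-ymgap`, YM-PLAN Track A (D-0062 ∕ D-0149 width seats), seat `pub-ymgap-dag-n11-w1` (g0; WIDTH SEAT 1 of 4 on NODE n11 [B14]),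
route `BalabanUVNodes` rev 25, item K1⁷ `StabilityBAtRecordR13SepCoPH` = stmt-QuantumFields-20542; DEFINITION lane (`--kind definition --supports 20542 --as helper`),
count-neutral.  [III] = [Balaban1988Convergent], [I] = [Balaban1987RG1].  Sequel of this seat's `…N11GaussianCertificateRows` (the CLASS, hypothesis-keyed) in the manner of
dag-n11-d's `…N11RePinnedParamDefs` (`rePinH`): ONE `def` and its faces, so that consumers can NAME the Gaussian witness (`gaussPinH θ`) exactly as they name `rePinH θ`.

WHAT THIS FILE DEFINES ∕ PROVES (1 `def`, theorems otherwise; 0 `sorry`).  `gaussPinH θ := ⟨θ.toStage13RParams, fun p _ Ω Λ => ⟨(ZhPinOfRecord₁₃ θ.toStage13Params p Ω Λ).ζ0,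
fun j Λ′ ω => Σ_{b ∈ bonds_j(Λ′ᶜ ∩ Ω (j+1))} ‖(ω j).2 b‖²⟩, θ.Phih⟩`; `rfl` faces `gaussPinH_toStage13RParams ∕ _toStage13Params ∕ _Phih ∕ _ζ0 ∕ _quad`, `rePinH_gaussPinH` (re-pinning the
Gaussian certificate à la dag-n11-d gives back `rePinH θ`), `gaussPinH_rePinH`, `gaussPinH_gaussPinH`; ★ `antecedent_gaussPinH` (the K⁷ antecedent transfers, `ZhUnity` unconditional) and
`exists_gaussPinH_of_exists` (K0⁷'s body ⇒ a Gaussian-certificate inhabitant); ★★★ `exists_local_witness_clause_succ_gaussPinH_of_termRows` and ★★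
`noExpansionTStepAt_gaussPinH_of_operandRows` — the class theorems of `…N11GaussianCertificateRows` AT THE NAMED WITNESS: the no-expansion 𝐓-step at `gaussPinH θ` at EVERY
no-expansion history modulo def-T's term ∕ operand rows ONLY (no (K0b) row, no thin-region exception).

HONEST FRAMING.  One definition of a bookkeeping witness + kernel composition; nothing of Bałaban asserted; the Gaussian `quad` is a RANGE value with the right rows, NOT
node00-def-K0b's value of record ([I]'s `C*Δ^{(j)}C − …` at the background), and — dag-n11-w4's caveat — it serves the NO-EXPANSION analysis only (the expansion
children see print's `𝒬_j`).  N11 NOT discharged; K1⁷ NOT closed; counts unmoved (typed 28∕28 · discharged 5∕27).  R4 closes only the conditional finite-𝕋⁴ rung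
`BalabanLadder.UV` of one programme at fixed `ε = L^{−K}` — NOT ℝ⁴, NOT OS, NOT a mass gap, NOT Clay.  No `sorry`, `axiom`, `instance`, `notation`.
Sources (SHAPE only): [III] Thm 1 p.262, (2.21) p.258, (3.16)–(3.22) pp.268–269, (3.23)–(3.25) p.270; [I] (1.4)–(1.5) pp.260–261.
-/

noncomputable section

open MeasureTheory
open scoped BigOperators ENNReal NNReal Matrix.Norms.L2Operator

namespace Summit.QuantumFields.YangMills.Theorems.BalabanUVNodesN11GaussianCertificateDefs

open Literature.MathematicalPhysics.QuantumFieldTheory.Balaban1983to89 T4Continuum Node00 Node00.Tk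
open B10Eq42TorusConstraint (bondsIn)
open B15DeterminingSets (MSField)
open BalabanUVNodesN11RePinnedParamDefs
open BalabanUVNodesN11HistoryPinnedResidualDefs (ZhPinOfRecord₁₃)
open BalabanUVNodesN11FluctTruncationDefs (IsFluctLocal)
open BalabanUVNodesN11Sect3SupplyDefs (NoExpansionTStepAt)
open BalabanUVNodesN11GaussianCertificateRows

variable {F : T4Family} {N : ℕ} [NeZero N]

section Def

variable (θ : Stage13HParams F N)

/-- **THE GAUSSIAN CERTIFICATE OF A v1.7 PARAMETER**: `θ` with its history-indexed residual 𝐓-weight slot replaced by (dag-n11-d's certificate factor `ζ0`, THE GAUSSIAN OF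
THE INTEGRATED VARIABLES as `quad`) — every other field unchanged.  The named member of the class of `…N11GaussianCertificateRows`.
[cite: Balaban1988Convergent, (2.21) p.258, (3.16)–(3.20) pp.268–269; Balaban1987RG1, (1.4)–(1.5) pp.260–261] -/
def gaussPinH : Stage13HParams F N :=
  ⟨θ.toStage13RParams,
    fun p _ Ω Λ => ⟨(ZhPinOfRecord₁₃ θ.toStage13Params p Ω Λ).ζ0,
      fun j Λ' ω => ∑ b ∈ (Set.toFinite (bondsIn j (Λ'ᶜ ∩ Ω (j + 1)))).toFinset, ‖(ω j).2 b‖ ^ 2⟩,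
    θ.Phih⟩

/-- The Stage-13R part is unchanged (`rfl`). [cite: Balaban1988Convergent, (3.16) p.268 (bookkeeping)] -/
@[simp] theorem gaussPinH_toStage13RParams : (gaussPinH θ).toStage13RParams = θ.toStage13RParams := rfl

/-- The Stage-13 part is unchanged (`rfl`). [cite: Balaban1988Convergent, (3.16) p.268 (bookkeeping)] -/
theorem gaussPinH_toStage13Params : (gaussPinH θ).toStage13Params = θ.toStage13Params := rfl

/-- The smearing functions are unchanged (`rfl`). [cite: Balaban1988Convergent, (2.24)–(2.25) p.259 (bookkeeping)] -/
@[simp] theorem gaussPinH_Phih : (gaussPinH θ).Phih = θ.Phih := rfl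

/-- The class hypothesis `hζ` at the named witness: its residual factor is the certificate's (`rfl`). [cite: Balaban1988Convergent, (3.16)–(3.20) pp.268–269 (bookkeeping)] -/
theorem gaussPinH_ζ0 : ∀ (p : B12.RunParams) (n : ℕ) (Ω Λ : ℕ → Set (Site (F.P p.K) 0)),
    ((gaussPinH θ).Zh p n Ω Λ).ζ0 = (ZhPinOfRecord₁₃ (gaussPinH θ).toStage13Params p Ω Λ).ζ0 := fun _ _ _ _ => rfl

/-- The class hypothesis `hq` at the named witness: its form is the Gaussian of the integrated variables (`rfl`). [cite: Balaban1988Convergent, (2.21) p.258 (bookkeeping)] -/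
theorem gaussPinH_quad : ∀ (p : B12.RunParams) (n : ℕ) (Ω Λ : ℕ → Set (Site (F.P p.K) 0)) (j : ℕ) (Λ' : Set (Site (F.P p.K) 0))
    (ω : MultiCfg (F.P p.K) (SU N) (FluctV N)),
    ((gaussPinH θ).Zh p n Ω Λ).quad j Λ' ω = ∑ b ∈ (Set.toFinite (bondsIn j (Λ'ᶜ ∩ Ω (j + 1)))).toFinset, ‖(ω j).2 b‖ ^ 2 := fun _ _ _ _ _ _ _ => rfl

/-- dag-n11-d's re-pinning of the Gaussian certificate is dag-n11-d's certificate (`rfl`: `rePinH` reads the Stage-13 part only). [cite: Balaban1988Convergent, (3.16) p.268 (bookkeeping)] -/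
theorem rePinH_gaussPinH : rePinH (gaussPinH θ) = rePinH θ := rfl

/-- The Gaussian certificate of dag-n11-d's certificate is the Gaussian certificate (`rfl`). [cite: Balaban1988Convergent, (3.16) p.268 (bookkeeping)] -/
theorem gaussPinH_rePinH : gaussPinH (rePinH θ) = gaussPinH θ := rfl

/-- Pinning twice is pinning once (`rfl`). [cite: Balaban1988Convergent, (3.16) p.268 (bookkeeping)] -/
theorem gaussPinH_gaussPinH : gaussPinH (gaussPinH θ) = gaussPinH θ := rfl

end Def

section Antecedent

variable {θ : Stage13HParams F N}

/-- **★ THE K⁷ ANTECEDENT TRANSFERS TO THE GAUSSIAN CERTIFICATE** (as dag-n11-d's `antecedent_rePinH`; `ZhUnity` unconditional): `…GaussianCertificateRows.exists_gaussCert_of_antecedent`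
builds exactly `gaussPinH θ`. [cite: Balaban1988Convergent, Thm 1 p.262, (3.16)–(3.22) pp.268–269 (bookkeeping)] -/
theorem antecedent_gaussPinH (h : θ.Provisos₁₃SepCoPH F N) (hnd : θ.SlotsNondegenerate₁₃ F N) (hadm : θ.Admissible F N) :
    (gaussPinH θ).Provisos₁₃SepCoPH F N ∧ ((gaussPinH θ).ZhUnity F N ∧ (gaussPinH θ).SlotsNondegenerate₁₃ F N) ∧ (gaussPinH θ).Admissible F N := by
  refine ⟨?_, ⟨zhUnity_of_gaussCert (gaussPinH θ) (gaussPinH_ζ0 θ), hnd⟩, hadm⟩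
  exact
    { intPiece := h.intPiece
      measω := h.measω
      measChi := h.measChi
      zetaUnity := h.zetaUnity
      zetaAbs := h.zetaAbs
      rstep := fun p k _ hk => h.rstep p k hk
      rzLaws := h.rzLaws
      zhLaws := fun p _ Ω Λ =>
        ⟨(BalabanUVNodesN11HistoryPinnedResidualDefs.laws_ZhPinOfRecord₁₃ (θ := θ.toStage13Params) (p := p) h.zetaUnity Ω Λ).zeta0_nonneg⟩
      zhLocal := fun p _ Ω Λ =>
        ⟨(BalabanUVNodesN11HistoryPinnedResidualDefs.localLaws_ZhPinOfRecord₁₃ (θ := θ.toStage13Params) (p := p) Ω Λ).zeta0_local⟩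
      hM := h.hM
      hM₁ := h.hM₁
      bg := h.bg }

/-- **… in the shape of K0⁷'s body**: an inhabitant of the antecedent gives a Gaussian-certificate inhabitant. [cite: Balaban1988Convergent, Thm 1 p.262 (bookkeeping)] -/
theorem exists_gaussPinH_of_exists
    (h : ∃ θ : Stage13HParams F N, θ.Provisos₁₃SepCoPH F N ∧ (θ.ZhUnity F N ∧ θ.SlotsNondegenerate₁₃ F N) ∧ θ.Admissible F N) :
    ∃ θ : Stage13HParams F N, gaussPinH θ = θ ∧ θ.Provisos₁₃SepCoPH F N ∧ (θ.ZhUnity F N ∧ θ.SlotsNondegenerate₁₃ F N) ∧ θ.Admissible F N := by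
  obtain ⟨θ, hP, ⟨-, hnd⟩, hadm⟩ := h
  exact ⟨gaussPinH θ, gaussPinH_gaussPinH θ, antecedent_gaussPinH hP hnd hadm⟩

/-- The core provisos transfer too (projection of the separated-range ones is dag-n11-d's business; here directly from `θ`'s core provisos).
[cite: Balaban1988Convergent, (2.18) p.257, (2.21) p.258, (3.16) p.268 (bookkeeping)] -/
theorem provisos₁₃CoPH_gaussPinH (h : θ.Provisos₁₃CoPH F N) : (gaussPinH θ).Provisos₁₃CoPH F N where
  intPiece := h.intPiece
  measω := h.measω
  measChi := h.measChi
  zetaUnity := h.zetaUnity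
  zetaAbs := h.zetaAbs
  rstep := fun p k _ hk => h.rstep p k hk
  rzLaws := h.rzLaws
  zhLaws := fun p _ Ω Λ =>
    ⟨(BalabanUVNodesN11HistoryPinnedResidualDefs.laws_ZhPinOfRecord₁₃ (θ := θ.toStage13Params) (p := p) h.zetaUnity Ω Λ).zeta0_nonneg⟩
  zhLocal := fun p _ Ω Λ =>
    ⟨(BalabanUVNodesN11HistoryPinnedResidualDefs.localLaws_ZhPinOfRecord₁₃ (θ := θ.toStage13Params) (p := p) Ω Λ).zeta0_local⟩

end Antecedent

section Step

variable (θ : Stage13HParams F N) (p : B12.RunParams)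

/-- **★★★ THE NO-EXPANSION 𝐓-STEP AT THE GAUSSIAN CERTIFICATE, def-T's TERM ROWS ONLY**, at every no-expansion history (the class theorem
`exists_local_witness_clause_succ_of_sLaw₁₃CoPH_of_gaussCert_of_termRows` at the named witness; core provisos of `θ`).
[cite: Balaban1988Convergent, Theorem p.245, Thm 1 p.262, (3.24)–(3.25) p.270, (2.21)–(2.23) p.258, (2.27) p.259] -/
theorem exists_local_witness_clause_succ_gaussPinH_of_termRows (h : θ.Provisos₁₃CoPH F N) {k : ℕ} (hk : k < p.K) (hM : 1 ≤ θ.τ9.M)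
    (hS : SLaw₁₃CoPH F N (gaussPinH θ) p k) :
    ∃ (t : SeqOfRecord F θ.ν θ.τ9.M (gOfRecord₁₃ F N θ.toStage13Params p) p.K k → Sect2.TermValues (F.P p.K) (MatA N) (FluctV N) θ.τ9.M)
      (Ek : SeqOfRecord F θ.ν θ.τ9.M (gOfRecord₁₃ F N θ.toStage13Params p) p.K k → ℝ),
      HasSect2FormAtZS F N (FluctV N) p.K (settingOfRecord₁₃ F N θ.toStage13Params p) k (θ.rzAt p) (WtOfRecord₁₃H F N (gaussPinH θ) p)
          (UbgOfRecord₁₃CoP F N θ.toStage13Params p k)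
          (fun s₀ t₀ => Sect2.LawsRT (sect2TowerOfRecord F N (FluctV N) p.K (settingOfRecord₁₃ F N θ.toStage13Params p) (θ.rzAt p s₀) s₀ t₀)
            (settingOfRecord₁₃ F N θ.toStage13Params p).lf k)
          (slotsOfRecord F N θ.ν θ.τ9 (EOfRecord₁₃ F N θ.toStage13Params) (wOfRecord₉ F N θ.toStage9Params) θ.ppSel p
            (gOfRecord₁₃ F N θ.toStage13Params p) k) t Ek ∧
      (∀ s₀, IsFluctLocal k (t s₀)) ∧
      ∀ (s : SeqOfRecord F θ.ν θ.τ9.M (gOfRecord₁₃ F N θ.toStage13Params p) p.K (k + 1)), s.Ω (k + 1) = ∅ →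
        -- def-T: the term values of the witness at the parent history, READ AT THE EMBEDDED BACKGROUND, are measurable …
        (∀ (j : ℕ) (X : (Sect2.domSys (F.P p.K) θ.τ9.M j).Dom) (z : Site (F.P p.K) j) (g' : ℝ),
          Measurable (fun U : GaugeField (F.P p.K) 0 (SU N) => ((t s.init).E j X z g' (Sect2.ofBackgroundC (settingOfRecord₁₃ F N θ.toStage13Params p).ι U)).re)) →
        (∀ (j : ℕ) (X : (Sect2.domSys (F.P p.K) θ.τ9.M j).Dom),
          Measurable (fun U : GaugeField (F.P p.K) 0 (SU N) => ((t s.init).R j X (Sect2.ofBackgroundC (settingOfRecord₁₃ F N θ.toStage13Params p).ι U)).re)) →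
        (∀ (S' : ℕ → Set (Site (F.P p.K) 0)) (j : ℕ) (X : (Sect2.domSys (F.P p.K) θ.τ9.M j).Dom),
          Measurable (fun q : GaugeField (F.P p.K) 0 (SU N) × MSFluct (F.P p.K) (FluctV N) =>
            ((t s.init).B j X (Sect2.ofBackgroundC (settingOfRecord₁₃ F N θ.toStage13Params p).ι q.1) (S', q.2)).re)) →
        -- … and uniformly bounded
        (∃ CE : ℝ, ∀ (j : ℕ) (X : (Sect2.domSys (F.P p.K) θ.τ9.M j).Dom) (z : Site (F.P p.K) j) (g' : ℝ) (U : GaugeField (F.P p.K) 0 (SU N)),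
          |((t s.init).E j X z g' (Sect2.ofBackgroundC (settingOfRecord₁₃ F N θ.toStage13Params p).ι U)).re| ≤ CE) →
        (∃ CR : ℝ, ∀ (j : ℕ) (X : (Sect2.domSys (F.P p.K) θ.τ9.M j).Dom) (U : GaugeField (F.P p.K) 0 (SU N)),
          |((t s.init).R j X (Sect2.ofBackgroundC (settingOfRecord₁₃ F N θ.toStage13Params p).ι U)).re| ≤ CR) →
        (∃ CB : ℝ, ∀ (j : ℕ) (X : (Sect2.domSys (F.P p.K) θ.τ9.M j).Dom) (U : GaugeField (F.P p.K) 0 (SU N)) (a : Tk.SFluct (F.P p.K) (FluctV N)),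
          |((t s.init).B j X (Sect2.ofBackgroundC (settingOfRecord₁₃ F N θ.toStage13Params p).ι U) a).re| ≤ CB) →
        (slotsTOfRecord F N θ.ν θ.τ9 (EOfRecord₁₃ F N θ.toStage13Params) (wOfRecord₉ F N θ.toStage9Params) θ.ppSel p
            (gOfRecord₁₃ F N θ.toStage13Params p) (k + 1) s = 0 ∨
          ∀ᵐ V' ∂fieldMeasure (F.P p.K) (k + 1) (SU N),
            chiSeqOfRecord F N θ.ν θ.τ9.M (gOfRecord₁₃ F N θ.toStage13Params p) p.K (k + 1) s V' ≠ 0 →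
              slotsTOfRecord F N θ.ν θ.τ9 (EOfRecord₁₃ F N θ.toStage13Params) (wOfRecord₉ F N θ.toStage9Params) θ.ppSel p
                  (gOfRecord₁₃ F N θ.toStage13Params p) (k + 1) s V' =
                sect2Slot F N (FluctV N) p.K (settingOfRecord₁₃ F N θ.toStage13Params p) (θ.rzAt p s) (WtOfRecord₁₃H F N (gaussPinH θ) p s) s
                  (t s.init) (Ek s.init) (UbgOfRecord₁₃CoP F N θ.toStage13Params p (k + 1) s) V') :=
  exists_local_witness_clause_succ_of_sLaw₁₃CoPH_of_gaussCert_of_termRows (gaussPinH θ) p (gaussPinH_ζ0 θ) (gaussPinH_quad θ)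
    (provisos₁₃CoPH_gaussPinH h) hk hM hS

/-- **★★ `NoExpansionTStepAt (gaussPinH θ) p k` FROM def-T's OPERAND ROWS ALONE** (dag-n11-e's deliverable at the named Gaussian witness; the class theorem
`noExpansionTStepAt_of_gaussCert_of_operandRows`). [cite: Balaban1988Convergent, Theorem p.245, (3.24)–(3.25) p.270, (2.23) p.258] -/
theorem noExpansionTStepAt_gaussPinH_of_operandRows (h : θ.Provisos₁₃CoPH F N) {k : ℕ} (hk : k < p.K) (hM : 1 ≤ θ.τ9.M)
    (hops : ∀ (t : SeqOfRecord F θ.ν θ.τ9.M (gOfRecord₁₃ F N θ.toStage13Params p) p.K k → Sect2.TermValues (F.P p.K) (MatA N) (FluctV N) θ.τ9.M)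
      (Ek : SeqOfRecord F θ.ν θ.τ9.M (gOfRecord₁₃ F N θ.toStage13Params p) p.K k → ℝ),
      HasSect2FormAtZS F N (FluctV N) p.K (settingOfRecord₁₃ F N θ.toStage13Params p) k (θ.rzAt p) (WtOfRecord₁₃H F N (gaussPinH θ) p)
        (UbgOfRecord₁₃CoP F N θ.toStage13Params p k)
        (fun s u => Sect2.LawsRT (sect2TowerOfRecord F N (FluctV N) p.K (settingOfRecord₁₃ F N θ.toStage13Params p) (θ.rzAt p s) s u)
          (settingOfRecord₁₃ F N θ.toStage13Params p).lf k)
        (slotsOfRecord F N θ.ν θ.τ9 (EOfRecord₁₃ F N θ.toStage13Params) (wOfRecord₉ F N θ.toStage9Params) θ.ppSel p (gOfRecord₁₃ F N θ.toStage13Params p) k) t Ek →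
      (∀ s₀, IsFluctLocal k (t s₀)) →
      ∀ s : SeqOfRecord F θ.ν θ.τ9.M (gOfRecord₁₃ F N θ.toStage13Params p) p.K (k + 1), s.Ω (k + 1) = ∅ →
        ∀ S ∈ admSOfRecord F θ.ν θ.τ9.M (gOfRecord₁₃ F N θ.toStage13Params p) p.K k s.init,
          Measurable (fun ω : MultiCfg (F.P p.K) (SU N) (FluctV N) =>
            sect2Operand F N (FluctV N) p.K (settingOfRecord₁₃ F N θ.toStage13Params p) (θ.rzAt p s.init) s.init (t s.init) (Ek s.init)
                (UbgOfRecord₁₃CoP F N θ.toStage13Params p k s.init) (S, fun j => (ω j).2) (fun j => (ω j).1)) ∧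
          ∃ CΦ : ℝ, ∀ a U, sect2Operand F N (FluctV N) p.K (settingOfRecord₁₃ F N θ.toStage13Params p) (θ.rzAt p s.init) s.init (t s.init) (Ek s.init)
                (UbgOfRecord₁₃CoP F N θ.toStage13Params p k s.init) a U ≤ CΦ) :
    NoExpansionTStepAt (gaussPinH θ) p k :=
  noExpansionTStepAt_of_gaussCert_of_operandRows (gaussPinH θ) p (gaussPinH_ζ0 θ) (gaussPinH_quad θ) (provisos₁₃CoPH_gaussPinH h) hk hM hops

end Step

end Summit.QuantumFields.YangMills.Theorems.BalabanUVNodesN11GaussianCertificateDefs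

end
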